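import Mathlib
import Literature.RepresentationTheory.FiniteGroups.KLRGradedCellularBasis
import Summits.MatrixMultiplication.MatrixMultiplication.Theorems.SnSubsetDichotomyNoThresholdSubsetTripleUpBranching

/-!
# The prefix block count `t! · #{(λ, S, T) : T|_{<t} = U} = n! · f^Y`

Line `klr-graded-polynomial-method`, crux `SnSubsetDichotomy.NoThresholdSubsetTriple` (stmt-MatrixMultiplication-8302),
stub `prefix_block_card`: the combinatorial core of the MODEL theorem (the prefix-shape process of a uniform same-shape
pair of standard Young tableaux with `n` cells is the Plancherel growth process).

For `t ≤ n`, a Young diagram `Y` with `t` cells and a standard Young tableau `U` of shape `Y`, the same-shape pairs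
`(λ, S, T)` (`TableauPair n`) whose second tableau `T` extends `U` (the entries `< t` of `T` sit where `U` puts them)
number `B(U)` with `t! · B(U) = n! · f^Y`, `f^Y = #SYT(Y)`.

Proof: downward induction on `t`.  For `t = n` the shape `λ` is forced (`λ` and `Y` have the same cells), `T = U`
and `S ∈ SYT(Y)` is free, so `B(U) = f^Y`.  For `t < n` the entry `t` of `T` sits at an addable node `y` of `Y`
and `T` extends the tableau `U_y ∈ SYT(Y ∪ y)` (`U` with `t ↦ y`); so `B(U) = Σ_y B(U_y)`, and by induction and the
up-branching rule `sum_card_stdFilling_insert` (`Σ_y f^{Y ∪ y} = (t+1) f^Y`),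
`(t+1)! · B(U) = n! · Σ_y f^{Y∪y} = (t+1) · n! · f^Y`.
-/

open scoped BigOperators
open Literature.RepresentationTheory.FiniteGroups (addableNodes IsAddableNode TableauPair)
open Literature.NumberTheory.DiophantineGeometry (StdFilling)

namespace Summit.MatrixMultiplication.MatrixMultiplication.Theorems

/-! ### Diagrams: adding an addable node, the partition of a diagram -/

set_option linter.dupNamespace false in
/-- Adding an addable node to a lower set of cells gives again a lower set. -/
private theorem isLowerSet_insert_addable {ν : Finset (ℕ × ℕ)} (hν : IsLowerSet (ν : Set (ℕ × ℕ)))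
    {z : ℕ × ℕ} (hz : IsAddableNode ν z) :
    IsLowerSet ((insert z ν : Finset (ℕ × ℕ)) : Set (ℕ × ℕ)) := by
  -- adapted from `SnSubsetDichotomyNoThresholdSubsetTripleSqChange` (same namespace, private there)
  obtain ⟨r, c⟩ := z
  obtain ⟨-, hup, hleft⟩ := hz
  dsimp only at hup hleft
  rintro ⟨a₁, a₂⟩ ⟨b₁, b₂⟩ hba ha
  obtain ⟨h₁, h₂⟩ := Prod.mk_le_mk.1 hba
  simp only [Finset.coe_insert, Set.mem_insert_iff, Finset.mem_coe, Prod.mk.injEq] at ha ⊢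
  rcases ha with ⟨rfl, rfl⟩ | ha
  · by_cases hb : b₁ = a₁ ∧ b₂ = a₂
    · exact Or.inl hb
    · refine Or.inr ?_
      rcases Nat.lt_or_ge b₁ a₁ with hlt | hge
      · exact Finset.mem_coe.1 (hν (Prod.mk_le_mk.2 ⟨Nat.le_sub_one_of_lt hlt, h₂⟩)
          (Finset.mem_coe.2 (hup.resolve_left (by omega))))
      · have hb₂ : b₂ < a₂ := by omega
        exact Finset.mem_coe.1 (hν (Prod.mk_le_mk.2 ⟨h₁, Nat.le_sub_one_of_lt hb₂⟩)
          (Finset.mem_coe.2 (hleft.resolve_left (by omega))))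
  · exact Or.inr (Finset.mem_coe.1 (hν hba (Finset.mem_coe.2 ha)))

set_option linter.dupNamespace false in
/-- The Young diagrams `Y ∪ {y}`, `y` an addable node of `Y`, as one function of `y` (as `sum_card_stdFilling_insert`
wants them). -/
private theorem exists_insDiag (Y : YoungDiagram) :
    ∃ ins : ℕ × ℕ → YoungDiagram, ∀ y, IsAddableNode Y.cells y → (ins y).cells = insert y Y.cells :=
  ⟨fun y => if h : IsAddableNode Y.cells y then ⟨insert y Y.cells, isLowerSet_insert_addable Y.isLowerSet h⟩
    else Y, fun y h => by dsimp only; rw [dif_pos h]⟩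

set_option linter.dupNamespace false in
/-- Every Young diagram with `n` cells is the diagram of a partition of `n` (parts = row lengths). -/
private theorem exists_partition_eq {n : ℕ} {Y : YoungDiagram} (hY : Y.cells.card = n) :
    ∃ μ : Nat.Partition n, μ.youngDiagram = Y := by
  -- adapted from `PolynomialSlack.exists_partition_youngDiagram_eq` (…PolynomialSlackSpechtBranching)
  subst hY
  let μ : Nat.Partition Y.cells.card :=
    { parts := (Y.rowLens : Multiset ℕ)
      parts_pos := fun h => Y.pos_of_mem_rowLens _ (Multiset.mem_coe.mp h)
      parts_sum := by rw [Multiset.sum_coe, YoungDiagram.sum_rowLens] }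
  have hsorted : μ.sortedParts = Y.rowLens := by
    change Multiset.sort (Y.rowLens : Multiset ℕ) (· ≥ ·) = _
    rw [Multiset.coe_sort]
    exact List.mergeSort_eq_self _ (YoungDiagram.rowLens_sorted _).pairwise
  have key : ∀ (l₁ l₂ : List ℕ) (h₁ : l₁.SortedGE) (h₂ : l₂.SortedGE), l₁ = l₂ →
      YoungDiagram.ofRowLens l₁ h₁ = YoungDiagram.ofRowLens l₂ h₂ := by
    rintro l₁ l₂ h₁ h₂ rfl; rfl
  exact ⟨μ, (key _ _ _ (YoungDiagram.rowLens_sorted _) hsorted).trans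
    YoungDiagram.ofRowLens_to_rowLens_eq_self⟩

set_option linter.dupNamespace false in
/-- A same-shape pair is determined by its two raw growth sequences (a partition is determined by its
diagram, and the diagram is the set of cells of the first tableau). -/
private theorem tableauPair_eq_of_val_eq {n : ℕ} {i j : TableauPair n} (h₁ : i.2.1.1 = j.2.1.1)
    (h₂ : i.2.2.1 = j.2.2.1) : i = j := by
  -- adapted from `KlrLine.tableauPair_eq_of_val_eq` (…NoThresholdSubsetTripleSmallWeightTail, private)
  obtain ⟨μ, S, T⟩ := i
  obtain ⟨ν, S', T'⟩ := j
  dsimp only at h₁ h₂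
  have hμν : μ = ν := by
    have hd : μ.youngDiagram = ν.youngDiagram := by
      refine YoungDiagram.ext (Finset.ext fun x => ?_)
      rw [YoungDiagram.mem_cells, YoungDiagram.mem_cells]
      constructor
      · intro hx
        obtain ⟨p, rfl⟩ := S.exists_eq μ.card_cells_youngDiagram hx
        rw [show S.1 p = S'.1 p from congrFun h₁ p]
        exact S'.mem p
      · intro hx
        obtain ⟨p, rfl⟩ := S'.exists_eq ν.card_cells_youngDiagram hx
        rw [← show S.1 p = S'.1 p from congrFun h₁ p]
        exact S.mem p
    ext1
    rw [← Multiset.sort_eq μ.parts (· ≥ ·), ← Multiset.sort_eq ν.parts (· ≥ ·)]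
    change (μ.sortedParts : Multiset ℕ) = ν.sortedParts
    rw [← μ.rowLens_youngDiagram, ← ν.rowLens_youngDiagram, hd]
  subst hμν
  have hS : S = S' := Subtype.ext h₁
  have hT : T = T' := Subtype.ext h₂
  subst hS
  subst hT
  rfl

/-! ### The block of a prefix tableau: base case, fibres over the next cell -/

set_option linter.dupNamespace false in
/-- Base case `t = n`: the pairs whose second tableau is `U ∈ SYT(Y)` are the `(λ_Y, S, U)`, `S ∈ SYT(Y)`. -/
private theorem card_block_top {n : ℕ} {Y : YoungDiagram} (hY : Y.cells.card = n)
    (U : StdFilling n Y) :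
    Nat.card {ω : TableauPair n // ∀ k : Fin n, ω.2.2.1 k = U.1 k} = Nat.card (StdFilling n Y) := by
  obtain ⟨μ₀, hμ₀⟩ := exists_partition_eq hY
  have hmemY : ∀ ω : {ω : TableauPair n // ∀ k : Fin n, ω.2.2.1 k = U.1 k},
      ∀ x ∈ ω.1.1.youngDiagram, x ∈ Y := by
    intro ω x hx
    obtain ⟨k, rfl⟩ := ω.1.2.2.exists_eq ω.1.1.card_cells_youngDiagram hx
    rw [ω.2 k]
    exact U.mem k
  refine Nat.card_eq_of_bijective
    (fun ω => (⟨ω.1.2.1.1, fun p => hmemY ω _ (ω.1.2.1.mem p), ω.1.2.1.injective,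
      fun p q h => ω.1.2.1.not_le h⟩ : StdFilling n Y)) ⟨fun ω ω' h => ?_, fun S => ?_⟩
  · exact Subtype.ext (tableauPair_eq_of_val_eq (i := ω.1) (j := ω'.1) (congrArg Subtype.val h)
      (funext fun k => (ω.2 k).trans (ω'.2 k).symm))
  · exact ⟨⟨⟨μ₀, ⟨S.1, by rw [hμ₀]; exact S.2⟩, ⟨U.1, by rw [hμ₀]; exact U.2⟩⟩, fun _ => rfl⟩, rfl⟩

set_option linter.dupNamespace false in
/-- Counting a finite subtype along the fibres of a map into a finset. -/
private theorem card_subtype_eq_sum {α : Type*} [Finite α] (P : α → Prop) (f : α → ℕ × ℕ)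
    (A : Finset (ℕ × ℕ)) (hA : ∀ a, P a → f a ∈ A) :
    Nat.card {a // P a} = ∑ y ∈ A, Nat.card {a // P a ∧ f a = y} := by
  rw [← Nat.card_congr (Equiv.sigmaSubtypeFiberEquiv (fun a : {a // P a} => f a.1) (fun y => y ∈ A)
    fun a => hA a.1 a.2), Nat.card_sigma, ← Finset.sum_coe_sort A]
  exact Finset.sum_congr rfl fun y _ => Nat.card_congr
    (Equiv.subtypeSubtypeEquivSubtypeInter P fun a => f a = y.1)

set_option linter.dupNamespace false in
/-- In a pair whose second tableau `T` extends `U ∈ SYT(Y)`, `|Y| = t < n`, the entry `t` of `T` sits at an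
addable node of `Y` (its upper and left neighbours carry smaller entries, and it is a new cell). -/
private theorem cell_mem_addableNodes {n t : ℕ} (htn : t < n) {Y : YoungDiagram}
    (hY : Y.cells.card = t) (U : StdFilling t Y) (ω : TableauPair n)
    (hω : ∀ k : Fin t, ω.2.2.1 ⟨k.1, lt_of_lt_of_le k.2 htn.le⟩ = U.1 k) :
    ω.2.2.1 ⟨t, htn⟩ ∈ addableNodes Y.cells := by
  obtain ⟨μ, S, T⟩ := ω
  dsimp only at hω ⊢
  -- every cell strictly north-west of the cell of `t` carries a smaller entry, hence lies in `Y`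
  have hC : ∀ x, x ≤ T.1 ⟨t, htn⟩ → x ≠ T.1 ⟨t, htn⟩ → x ∈ Y.cells := by
    intro x hle hne
    obtain ⟨j, rfl⟩ := T.exists_eq μ.card_cells_youngDiagram
      (μ.youngDiagram.isLowerSet hle (T.mem _))
    rcases lt_trichotomy j ⟨t, htn⟩ with hlt | rfl | hgt
    · have hjt : j.1 < t := hlt
      have h : T.1 j = U.1 ⟨j.1, hjt⟩ := hω ⟨j.1, hjt⟩
      rw [h]
      exact U.mem _
    · exact absurd rfl hne
    · exact absurd hle (T.not_le hgt)
  rw [Literature.RepresentationTheory.FiniteGroups.mem_addableNodes]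
  refine ⟨fun hy => ?_, ?_, ?_⟩
  · obtain ⟨k, hk⟩ := U.exists_eq hY ((YoungDiagram.mem_cells _).1 hy)
    have h := Fin.mk.inj_iff.1 (T.injective ((hω k).trans hk))
    have := k.2
    omega
  · refine (Nat.eq_zero_or_pos (T.1 ⟨t, htn⟩).1).imp_right fun hpos => hC _ ?_ ?_
    · exact Prod.mk_le_mk.2 ⟨Nat.sub_le _ _, le_rfl⟩
    · intro h
      have := congrArg Prod.fst h
      dsimp only at this
      omega
  · refine (Nat.eq_zero_or_pos (T.1 ⟨t, htn⟩).2).imp_right fun hpos => hC _ ?_ ?_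
    · exact Prod.mk_le_mk.2 ⟨le_rfl, Nat.sub_le _ _⟩
    · intro h
      have := congrArg Prod.snd h
      dsimp only at this
      omega

set_option linter.dupNamespace false in
/-- Extending `U ∈ SYT(Y)` by a new largest entry in a cell `y ∉ Y` gives a standard filling (`Fin.snoc U y`) of
any diagram with cells `Y ∪ {y}`. -/
private theorem exists_snocFilling {t : ℕ} {Y Y' : YoungDiagram} (U : StdFilling t Y) {y : ℕ × ℕ}
    (hy : y ∉ Y.cells) (hY' : Y'.cells = insert y Y.cells) :
    ∃ U' : StdFilling (t + 1) Y', U'.1 = Fin.snoc U.1 y := by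
  refine ⟨⟨Fin.snoc U.1 y, ?_⟩, rfl⟩
  have hmem : ∀ x, x ∈ Y' ↔ x = y ∨ x ∈ Y := fun x => by
    rw [← YoungDiagram.mem_cells, hY', Finset.mem_insert, YoungDiagram.mem_cells]
  have hne : ∀ p, U.1 p ≠ y := fun p h => hy ((YoungDiagram.mem_cells _).2 (h ▸ U.mem p))
  refine ⟨fun p => ?_, fun p q h => ?_, fun p q h => ?_⟩
  · rcases Fin.eq_castSucc_or_eq_last p with ⟨p, rfl⟩ | rfl
    · rw [Fin.snoc_castSucc]; exact (hmem _).2 (Or.inr (U.mem p))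
    · rw [Fin.snoc_last]; exact (hmem _).2 (Or.inl rfl)
  · rcases Fin.eq_castSucc_or_eq_last p with ⟨p, rfl⟩ | rfl <;>
      rcases Fin.eq_castSucc_or_eq_last q with ⟨q, rfl⟩ | rfl
    · rw [Fin.snoc_castSucc, Fin.snoc_castSucc] at h
      rw [U.injective h]
    · rw [Fin.snoc_castSucc, Fin.snoc_last] at h
      exact absurd h (hne p)
    · rw [Fin.snoc_castSucc, Fin.snoc_last] at h
      exact absurd h.symm (hne q)
    · rfl
  · rcases Fin.eq_castSucc_or_eq_last p with ⟨p, rfl⟩ | rfl <;>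
      rcases Fin.eq_castSucc_or_eq_last q with ⟨q, rfl⟩ | rfl
    · rw [Fin.snoc_castSucc, Fin.snoc_castSucc]
      exact U.not_le (Fin.castSucc_lt_castSucc_iff.1 h)
    · rw [Fin.snoc_castSucc, Fin.snoc_last]
      exact fun hle => hy (Y.isLowerSet hle (U.mem p))
    · exact absurd h (not_lt.2 (Fin.castSucc_lt_last q).le)
    · exact absurd h (lt_irrefl _)

set_option linter.dupNamespace false in
/-- Prescribing the first `t + 1` cells of a growth sequence by `Fin.snoc g y` means prescribing the first
`t` cells by `g` and the cell of the entry `t` by `y`. -/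
private theorem forall_snoc_iff {n t : ℕ} (ht : t ≤ n) (htn : t < n) (T : Fin n → ℕ × ℕ)
    (g : Fin t → ℕ × ℕ) (y : ℕ × ℕ) :
    ((∀ k : Fin t, T ⟨k.1, lt_of_lt_of_le k.2 ht⟩ = g k) ∧ T ⟨t, htn⟩ = y) ↔
      ∀ k : Fin (t + 1), T ⟨k.1, lt_of_lt_of_le k.2 htn⟩ = (Fin.snoc g y : Fin (t + 1) → ℕ × ℕ) k := by
  constructor
  · rintro ⟨h₁, h₂⟩ k
    refine Fin.lastCases ?_ (fun i => ?_) k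
    · rw [Fin.snoc_last]; exact h₂
    · rw [Fin.snoc_castSucc]; exact h₁ i
  · intro h
    refine ⟨fun k => ?_, ?_⟩
    · have := h (Fin.castSucc k); rwa [Fin.snoc_castSucc] at this
    · have := h (Fin.last t); rwa [Fin.snoc_last] at this

/-! ### The theorem -/

set_option linter.dupNamespace false in
/-- **Prefix block count** (model theorem, combinatorial core).  For `t ≤ n`, a Young diagram `Y` with `t` cells
and `U ∈ SYT(Y)`, the same-shape pairs `(λ, S, T) ∈ TableauPair n` whose second tableau extends `U` (its entries
`< t` sit where `U` puts them) number `B(U)` with `t! · B(U) = n! · f^Y`, `f^Y = Nat.card (StdFilling t Y)`: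
under the uniform measure on `TableauPair n` the prefix shapes of `T` form the Plancherel growth process
(with the hook-ratio identity `transProb_mul_card_stdFilling`).  Downward induction on `t` via the up-branching
rule `sum_card_stdFilling_insert`. -/
theorem prefix_block_card : ∀ (n t : ℕ) (ht : t ≤ n) (Y : YoungDiagram), Y.cells.card = t → ∀ (U : StdFilling t Y),
    t.factorial * Nat.card {ω : TableauPair n // ∀ k : Fin t, (ω.2.2).1 ⟨k.1, lt_of_lt_of_le k.2 ht⟩ = U.1 k} =
      n.factorial * Nat.card (StdFilling t Y) := by
  intro n t ht Y hY U
  obtain ⟨d, hd⟩ := Nat.exists_eq_add_of_le ht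
  induction d generalizing t Y with
  | zero =>
    rw [Nat.add_zero] at hd
    subst hd
    congr 1
    exact card_block_top hY U
  | succ d ih =>
    have htn : t < n := by omega
    obtain ⟨ins, hins⟩ := exists_insDiag Y
    -- the block of `U` splits along the cell `y` of the entry `t`, an addable node of `Y`
    have h1 := card_subtype_eq_sum
      (fun ω : TableauPair n => ∀ k : Fin t, ω.2.2.1 ⟨k.1, lt_of_lt_of_le k.2 ht⟩ = U.1 k)
      (fun ω => ω.2.2.1 ⟨t, htn⟩) (addableNodes Y.cells) fun ω hω => cell_mem_addableNodes htn hY U ω hω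
    -- each piece is the block of `U_y ∈ SYT(Y ∪ y)`, counted by the inductive hypothesis
    have h2 : ∀ y ∈ addableNodes Y.cells, (t + 1).factorial *
        Nat.card {ω : TableauPair n // (∀ k : Fin t, ω.2.2.1 ⟨k.1, lt_of_lt_of_le k.2 ht⟩ = U.1 k) ∧
          ω.2.2.1 ⟨t, htn⟩ = y} = n.factorial * Nat.card (StdFilling (t + 1) (ins y)) := by
      intro y hy
      have hy' := Literature.RepresentationTheory.FiniteGroups.mem_addableNodes.1 hy
      have hc : (ins y).cells.card = t + 1 := by
        rw [hins y hy', Finset.card_insert_of_notMem hy'.1, hY]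
      obtain ⟨U', hU'⟩ := exists_snocFilling U hy'.1 (hins y hy')
      rw [← ih (t + 1) htn (ins y) hc U' (by omega)]
      congr 1
      refine Nat.card_congr (Equiv.subtypeEquivRight fun ω => ?_)
      rw [hU']
      exact forall_snoc_iff ht htn ω.2.2.1 U.1 y
    -- up-branching
    have h4 : ∑ y ∈ addableNodes Y.cells, Nat.card (StdFilling (t + 1) (ins y)) =
        (t + 1) * Nat.card (StdFilling t Y) := by
      have h := sum_card_stdFilling_insert Y ins fun y hy =>
        hins y (Literature.RepresentationTheory.FiniteGroups.mem_addableNodes.1 hy)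
      rw [hY] at h
      exact_mod_cast h
    have key : (t + 1).factorial *
        Nat.card {ω : TableauPair n // ∀ k : Fin t, ω.2.2.1 ⟨k.1, lt_of_lt_of_le k.2 ht⟩ = U.1 k} =
          n.factorial * ((t + 1) * Nat.card (StdFilling t Y)) := by
      rw [h1, Finset.mul_sum, Finset.sum_congr rfl h2, ← Finset.mul_sum, h4]
    refine Nat.eq_of_mul_eq_mul_left (show 0 < t + 1 by omega) ?_
    rw [← Nat.mul_assoc, ← Nat.factorial_succ, key]
    ring

end Summit.MatrixMultiplication.MatrixMultiplication.Theorems
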